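import Literature.MathematicalPhysics.QuantumFieldTheory.Balaban1983to89.MassGapFunctionalInequalities
import HarnessLib

/-!
# Typed sufficient conditions for the Jaffe–Witten lattice mass-gap clause, §C: COMPUTABLE
# finite-scale criteria — Simon's domination criterion (kernel) and the missing transfer-gap bootstrap (schema)

HONEST FRAMING (audit package `pub-balaban`, seat `b2b-balaban-ir-3`, first generation, 2026-08-19). This module is a
sibling of `Balaban1983to89/MassGapFunctionalInequalities.lean` (seat ir-2, §§1–9), `MassGapBlockAxis.lean` (§10)
and the `InfiniteVolumeSufficient*` series (seat ir-1) and inherits their framing word for word: part of an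
AUTOPSY / instrument search toward leg (4) (the mass gap) of the Clay Yang–Mills problem as typed in
`YangMillsOS.lean`; it contains NO mass-gap claim. Everything here is either a KERNEL theorem of elementary real
analysis / bookkeeping, or an OPEN `def … : Prop` (hypothesis schema) asserted nowhere. Bałaban's papers (the
manuscripts under audit) are not cited for anything. Companion prose: `ir/CRITERIA.md` of the package (rows C2, C4,
C9), which asks, for each sufficient criterion for the gap found in print, whether a CERTIFIED FINITE COMPUTATION
could verify its hypothesis for the terminal-scale lattice theory — and answers no, for the reasons typed below.

TARGET. `HasLatticeMassGap r sch Δ` (`YangMillsOS.lean`): for all species `P, Q` one constant `C` with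
`|⟨P · τ_{n e₀} Q⟩_{k,S} − ⟨P⟩⟨Q⟩| ≤ C e^{−Δ a_k n}` eventually in `k`, on every torus `2S+1 ≥ 2L_k+1`, all `n ≤ S`.

CONTENTS.

§C1 SIMON'S ITERATION LEMMA (kernel, [Simon1980CMP, Thm 1.3] in one-dimensional sequence form). If a bounded
sequence `|f n| ≤ M` is DOMINATED AT FINITE RANGE, `|f n| ≤ Σ_{j=1}^{R} a_j |f(n−j)|` for `n ≥ R` with `a_j ≥ 0`,
`Σ a_j ≤ A ≤ 1`, then `|f n| ≤ M A^{⌊n/R⌋}` (`abs_le_mul_pow_div_of_domination`), hence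
`|f n| ≤ (M/A) e^{−m₀ n}` with Simon's rate `m₀ = −R⁻¹ log A` (`abs_le_mul_exp_neg_of_domination`). This is the
abstract half of every "computable finite-box criterion" for exponential decay in print (Simon–Lieb for
ferromagnets, Knabe for frustration-free chains, Dobrushin–Shlosman effectiveness): ONE inequality among finitely
many finite-volume quantities, iterated.

§C2 THE DOMINATION CRITERION ALONG THE SCHEME (schema + kernel). `UniformCorrDomination r sch R A`: eventually in
`k`, on every torus `S ≥ L_k`, the time correlations of every species pair are bounded by one `M` and dominated at
range `R_k` with total weight `≤ A_k`. KERNEL: `hasLatticeMassGap_of_uniformCorrDomination` — if moreover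
`θ ≤ A_k ≤ 1` for a fixed `θ > 0`, `R_k ≥ 1`, and Simon's rate beats the target, `Δ · a_k · R_k ≤ −log A_k`
eventually, then `HasLatticeMassGap r sch Δ`. The MODEL-SPECIFIC input — an inequality producing the domination
for correlations of a NON-ABELIAN lattice gauge theory, the analogue of the Simon–Lieb inequality
[Simon1980CMP, Thm 1.1], [Lieb1980] which rests on Griffiths' inequalities — does not exist in print and is not
posited here; for the ℤ₂ gauge theory in `d = 3` it holds through duality with the Ising model (package
`ir/COMPUTE-PLAN.md`, toy job J2). WHY THE RATE CONDITION IS THE WHOLE DIFFICULTY: with `R_k` of bounded physical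
size (`a_k R_k ≤ Θ`) the condition asks `A_k ≤ e^{−ΔΘ}` uniformly — a contraction by a FIXED factor over a FIXED
physical distance at every lattice spacing, which is the mass gap restated at one scale; with `R_k` bounded in
lattice units it asks `A_k → 1⁻` no faster than `1 − Δ a_k R_k`, a weak-coupling estimate with the physical mass in
its error term.

§C3 THE MISSING BOOTSTRAP FOR TRANSFER-MATRIX GAPS (schema + bookkeeping). Seat ir-2 typed the transfer gap
`TransferGap ρ β S m` (trace form, equivalent to the operator form for continuous unitary `ρ`, `β ≥ 0`) and proved
that EVERY finite torus has SOME positive gap (`exists_pos_transferGap`), so a certified gap on one torus carries no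
information about the uniform-in-volume gap that `UniformTransferGap` / the clause require — UNLESS a finite-size
criterion converts "gap `> θ` on the torus of half-side `S₀`" into "gap `≥ κ(m − θ)` on all larger tori". Such
criteria exist for frustration-free quantum spin chains ([Knabe1988]: `γ_N^{per} ≥ ((k−1)/(k−2))(γ_k − 1/(k−1))`;
[GossetMozgunov2016]) and nowhere in print for transfer matrices of lattice gauge theories. `TransferGapBootstrap ρ
S₀ θ κ` types the Knabe SHAPE as an open schema; `uniformTransferGap_of_bootstrap` is the bookkeeping showing what
it would buy (with ir-2's `TransferGapCertificate` downstream): `UniformTransferGap` from ONE finite-volume gap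
certificate PER COUPLING `β_k` — still infinitely many certificates along a scheme with `β_k → ∞`, so even the
bootstrap would not make leg (4) a finite computation (docstring of the theorem).

§C4 (v1.1, APPEND-ONLY, prose) CENSUS ADDENDUM at the end of the file: criteria C13–C16 of `ir/CRITERIA.md` v2
(multiscale Bakry–Émery / Polchinski-flow LSI; 't Hooft flux free energies; Migdal–Kadanoff recursions; unit-lattice
cluster expansion around a massive Gaussian) — sources, one-line verdicts, no declarations. v1.1 also re-tags one
heuristic remark in the docstring of `uniformTransferGap_of_bootstrap` as `[analysis, unsourced]` (referee note
C-t4r2-ir3-4); no statement, proof or declaration name changed.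

§C5 (v1.2, APPEND-ONLY) THE SMALL-PHYSICAL-VOLUME REGIME, row C20 of `ir/CRITERIA.md` v2.4: the one regime in which a
finite-volume continuum gap of `SU(2)` Yang–Mills is computed in print (Lüscher's zero-momentum effective Hamiltonian
on a small torus [Luscher1983], [LuscherMunster1984], review [Vanbaal2001]; discreteness of the reduced operator is
a theorem [SimonB1983DiscreteSpectrum, Cor. 4]). Two OPEN schemata in PHYSICAL units — `FloorTransferGap` (a transfer
gap `≥ μ₁ a_k` on a floor torus of `S₀ k` sites, eventually in `k`: the shape a finite-volume continuum-limit theorem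
would deliver) and `TransferGapBootstrapPhys` (the bootstrap of §C3 with floor and threshold allowed to depend on
`k`: the infrared continuation, NOT in print) — and the KERNEL bookkeeping `uniformTransferGap_of_floorGap`: together
they give `UniformTransferGap r sch (κ(μ₁ − μ₀) a_k)`, seat ir-2's currency. The §C3 schema is the constant special
case (`transferGapBootstrapPhys_of_bootstrap`). No new cited hypothesis; no claim; verdict of the census unchanged.
v1.3 (seat ir-3 gen 5, DOCFIX only, referee objection G-t4r2-ir3-4 / ruling C-t4r2-ir3-24, `t4/GAPS-T4.md` pass 8):
the attribution of the constant `4.1167…` in the §C5 section docstring is corrected — it is the LOWEST eigenvalue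
`ε₀⁺` of the reduced operator `h` as printed in [Pavel2010GlueballSpectrum, p. 10] («the lowest energies are ε₀⁺ = 4.1167,
ε₀⁻ = 8.7867»), the 9-digit value `4.116719735` being printed in [Vanbaal2001, §4] in a sentence that calls it
«ε₁ … determines to lowest order the mass of the scalar glueball»; the lowest-order scalar (0⁺) gap of `h` is
`μ₁ ≈ 2.270` [Pavel2010GlueballSpectrum, Table 1a], reproduced by package computation J4A (farm job j055337, D = 15: certified
`ε₀⁺ ≤ 4.116719769044`, `ε₁⁺ ≤ 6.386396130184`, `ε₀⁻ ≤ 8.786712661134`, exact rational Rayleigh–Ritz; no certified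
lower bound on `ε₁`, hence no certified gap — calibration only). No statement, proof or declaration name changed;
the constant occurs in no declaration (`FloorTransferGap` takes `μ₁` as a free real). v1.3.1 (same seat, minutes
later, ERRATUM): the Pavel reference line is corrected (title «Expansion of the Yang–Mills Hamiltonian in spatial
derivatives and glueball spectrum», doi:10.1016/j.physletb.2010.02.004) and cited under the corrected bib key
[Pavel2010GlueballSpectrum]; locators (p. 10, Table 1a of arXiv:0912.5465) and every quotation unchanged.

## References

* [Simon1980CMP] B. Simon, Correlation inequalities and the decay of correlations in ferromagnets, CMP 77 (1980)
  111–126: Thm 1.1 (the Simon–Lieb inequality), Thm 1.3 (the iteration lemma, (1.2)–(1.6)).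
* [Lieb1980] E. H. Lieb, A refinement of Simon's correlation inequality, CMP 77 (1980) 127–135.
* [Knabe1988] S. Knabe, Energy gaps and elementary excitations for certain VBS-quantum antiferromagnets, J. Stat.
  Phys. 52 (1988) 627–638 (finite-size criterion; quoted from M. Lemm, arXiv:1709.02756, Thm 1.2).
* [GossetMozgunov2016] D. Gosset, E. Mozgunov, Local gap threshold for frustration-free spin systems, J. Math.
  Phys. 57 (2016) 091901.
* [Martinelli1999] F. Martinelli, Lectures on Glauber dynamics for discrete spin models, LNM 1717 (1999): Def. 2.6
  (SMT), Thm 2.7, Prop. 2.9–2.12 (effectiveness of strong mixing: the Dobrushin–Shlosman finite-size criterion).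
* [JaffeWitten2000] A. Jaffe, E. Witten, Quantum Yang–Mills theory (Clay problem description), §5.
* (v1.1, §C4 prose only) R. Bauerschmidt, T. Bodineau, Log-Sobolev inequality for the continuum sine-Gordon model,
  CPAM 74 (2021) 2064–2113, arXiv:1907.12308; R. Bauerschmidt, T. Bodineau, B. Dagallier, Stochastic dynamics and
  the Polchinski equation: an introduction, Probab. Surveys 21 (2024), arXiv:2307.07619; H. Shen, R. Zhu, X. Zhu,
  CMP 400 (2023) 805–851, arXiv:2204.12737; J. Greensite, An Introduction to the Confinement Problem, LNP 821 (2011)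
  §4.2; T. G. Kovács, E. T. Tomboulis, PRL 85 (2000) 704, arXiv:hep-lat/0002004; K. R. Ito, E. Seiler,
  arXiv:0711.4930; T. Bałaban, J. Imbrie, A. Jaffe, D. Brydges, The mass gap for Higgs models on a unit lattice,
  Ann. Phys. 158 (1984) 281–319; A. Goswami, Mass gap in weakly coupled abelian Higgs on a unit lattice, AHP 20 (2019),
  arXiv:1811.00422.
* (v1.2, §C5) [Luscher1983] M. Lüscher, Some analytic results concerning the mass spectrum of Yang–Mills gauge
  theories on a torus, Nucl. Phys. B 219 (1983) 233–261 (not held; cited through [Vanbaal2001]);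
  [LuscherMunster1984] M. Lüscher, G. Münster, Weak-coupling expansion of the low-lying energy values in the SU(2)
  gauge theory on a torus, Nucl. Phys. B 232 (1984) 445–472 (not held; numbers quoted through [Vanbaal2001] and
  [Pavel2010GlueballSpectrum]); [Pavel2010GlueballSpectrum] H.-P. Pavel, Expansion of the Yang–Mills Hamiltonian in
  spatial derivatives and glueball spectrum, Phys. Lett. B 685 (2010) 353–364, doi:10.1016/j.physletb.2010.02.004,
  arXiv:0912.5465, p. 10 («the lowest energies are ε₀⁺ = 4.1167, ε₀⁻ = 8.7867») and Table 1a (`μ₁^{(0)+} = 2.270`,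
  `μ₁^{(2)+} = 1.898`) — v1.3.1 ERRATUM: v1.3 printed this entry with a wrong title, and the key `Pavel2010` filed in
  `references.bib` by this seat carries that wrong title and a wrong DOI; the corrected entry is the key
  `Pavel2010GlueballSpectrum` (same paper), which this file now cites; [Vanbaal2001] P. van Baal, QCD in a finite
  volume, in: At the Frontier of Particle Physics vol. 2 (World Scientific 2001) 683–760, arXiv:hep-ph/0008206, §§3–5;
  [SimonB1983DiscreteSpectrum] B. Simon, Some quantum operators with discrete spectrum but classically continuous
  spectrum, Ann. Phys. 146 (1983) 209–220, eq. (3) and Corollary 4 (p. 217).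
-/

noncomputable section

open MeasureTheory Filter Topology
open scoped BigOperators
open Literature.MathematicalPhysics.QuantumLattice Literature.MathematicalPhysics.QuantumFieldTheory

namespace Literature.MathematicalPhysics.QuantumFieldTheory.Balaban1983to89.Sufficient

/-! ### §C1 Simon's iteration lemma -/

section SimonIteration

/-- **Simon's iteration lemma, power form** ([Simon1980CMP, Thm 1.3], one-dimensional sequence version). A bounded
sequence, `|f n| ≤ M`, dominated at finite range `R` — `|f n| ≤ Σ_{j=1}^{R} a_j |f (n−j)|` for all `n ≥ R`, with
`a_j ≥ 0` and `Σ_{j=1}^{R} a_j ≤ A ≤ 1` — decays geometrically: `|f n| ≤ M · A^{⌊n/R⌋}`. (Simon's (1.2)–(1.4) with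
`B ⊂ {1,…,R}`; proof = his: iterate the domination `⌊n/R⌋` times, here as a strong induction.)
[cite: Simon1980CMP, Theorem 1.3] -/
theorem abs_le_mul_pow_div_of_domination {f : ℕ → ℝ} {M A : ℝ} {R : ℕ} {a : ℕ → ℝ}
    (hM : ∀ n, |f n| ≤ M) (ha : ∀ j, 0 ≤ a j) (hA : ∑ j ∈ Finset.Icc 1 R, a j ≤ A) (hA1 : A ≤ 1)
    (hdom : ∀ n, R ≤ n → |f n| ≤ ∑ j ∈ Finset.Icc 1 R, a j * |f (n - j)|) :
    ∀ n, |f n| ≤ M * A ^ (n / R) := by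
  have hM0 : 0 ≤ M := (abs_nonneg _).trans (hM 0)
  have hA0 : 0 ≤ A := (Finset.sum_nonneg fun j _ => ha j).trans hA
  rcases Nat.eq_zero_or_pos R with hR | hR
  · intro n
    simp [hR, hM n]
  intro n
  induction n using Nat.strong_induction_on with
  | _ n ih =>
    rcases lt_or_ge n R with hn | hn
    · rw [Nat.div_eq_of_lt hn, pow_zero, mul_one]
      exact hM n
    -- the domination step: `|f n| ≤ Σ a_j |f(n-j)| ≤ Σ a_j · M A^{(n-R)/R} ≤ A · M A^{(n-R)/R} = M A^{n/R}`
    have hdiv : n / R = (n - R) / R + 1 := by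
      conv_lhs => rw [← Nat.sub_add_cancel hn]
      exact Nat.add_div_right _ hR
    have hstep : ∀ j ∈ Finset.Icc 1 R, a j * |f (n - j)| ≤ a j * (M * A ^ ((n - R) / R)) := by
      intro j hj
      obtain ⟨hj1, hjR⟩ := Finset.mem_Icc.1 hj
      refine mul_le_mul_of_nonneg_left ?_ (ha j)
      have hlt : n - j < n := Nat.sub_lt (lt_of_lt_of_le hR hn) hj1
      refine (ih (n - j) hlt).trans (mul_le_mul_of_nonneg_left ?_ hM0)
      exact pow_le_pow_of_le_one hA0 hA1 (Nat.div_le_div_right (Nat.sub_le_sub_left hjR n))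
    calc |f n| ≤ ∑ j ∈ Finset.Icc 1 R, a j * |f (n - j)| := hdom n hn
      _ ≤ ∑ j ∈ Finset.Icc 1 R, a j * (M * A ^ ((n - R) / R)) := Finset.sum_le_sum hstep
      _ = (∑ j ∈ Finset.Icc 1 R, a j) * (M * A ^ ((n - R) / R)) := by rw [Finset.sum_mul]
      _ ≤ A * (M * A ^ ((n - R) / R)) :=
          mul_le_mul_of_nonneg_right hA (mul_nonneg hM0 (pow_nonneg hA0 _))
      _ = M * A ^ (n / R) := by rw [hdiv, pow_succ]; ring

/-- **Simon's iteration lemma, exponential form with Simon's rate `m₀ = −R⁻¹ log A`** ([Simon1980CMP, (1.5)–(1.6)]):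
under the hypotheses of `abs_le_mul_pow_div_of_domination` with `0 < A ≤ 1` and `R ≥ 1`,
`|f n| ≤ (M/A) · exp (−(−log A / R) · n)` for every `n` (the factor `1/A` pays for `⌊n/R⌋ ≥ n/R − 1`).
[cite: Simon1980CMP, Theorem 1.3] -/
theorem abs_le_mul_exp_neg_of_domination {f : ℕ → ℝ} {M A : ℝ} {R : ℕ} {a : ℕ → ℝ}
    (hM : ∀ n, |f n| ≤ M) (ha : ∀ j, 0 ≤ a j) (hA : ∑ j ∈ Finset.Icc 1 R, a j ≤ A) (hA0 : 0 < A)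
    (hA1 : A ≤ 1) (hR : 0 < R)
    (hdom : ∀ n, R ≤ n → |f n| ≤ ∑ j ∈ Finset.Icc 1 R, a j * |f (n - j)|) (n : ℕ) :
    |f n| ≤ M / A * Real.exp (-(-Real.log A / R * n)) := by
  have hM0 : 0 ≤ M := (abs_nonneg _).trans (hM 0)
  have hpow := abs_le_mul_pow_div_of_domination hM ha hA hA1 hdom n
  -- `A^{⌊n/R⌋} = exp(⌊n/R⌋ log A) ≤ exp((n/R - 1) log A) = exp((log A / R) n) / A`
  have hlogA : Real.log A ≤ 0 := Real.log_nonpos hA0.le hA1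
  have hfloor : (n : ℝ) / R - 1 ≤ ((n / R : ℕ) : ℝ) := by
    have h := Nat.lt_div_mul_add hR (a := n)
    have hRpos : (0 : ℝ) < R := by exact_mod_cast hR
    rw [sub_le_iff_le_add, div_le_iff₀ hRpos]
    have : (n : ℝ) < (n / R : ℕ) * R + R := by exact_mod_cast h
    linarith
  have hexp : A ^ (n / R) ≤ Real.exp (-(-Real.log A / R * n)) / A := by
    rw [le_div_iff₀ hA0]
    calc A ^ (n / R) * A = Real.exp (((n / R : ℕ) : ℝ) * Real.log A) * Real.exp (Real.log A) := by
            rw [Real.exp_nat_mul, Real.exp_log hA0]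
      _ = Real.exp ((((n / R : ℕ) : ℝ) + 1) * Real.log A) := by rw [← Real.exp_add]; ring_nf
      _ ≤ Real.exp ((n : ℝ) / R * Real.log A) := by
            refine Real.exp_le_exp.2 ?_
            have h1 : (n : ℝ) / R ≤ ((n / R : ℕ) : ℝ) + 1 := by linarith
            exact mul_le_mul_of_nonpos_right h1 hlogA
      _ = Real.exp (-(-Real.log A / R * n)) := by ring_nf
  calc |f n| ≤ M * A ^ (n / R) := hpow
    _ ≤ M * (Real.exp (-(-Real.log A / R * n)) / A) := mul_le_mul_of_nonneg_left hexp hM0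
    _ = M / A * Real.exp (-(-Real.log A / R * n)) := by ring

end SimonIteration

/-! ### §C2 The domination criterion along the scheme -/

variable {G : Type} [Group G] [MeasurableSpace G] [TopologicalSpace G] [IsTopologicalGroup G]
  [BorelSpace G] [CompactSpace G]
variable {N : ℕ} {ι : Type}

/-- **Uniform finite-range domination of time correlations along the scheme (hypothesis schema, row C4 of
`ir/CRITERIA.md`).** For every pair of species `P, Q` there is ONE bound `M` such that eventually in `k`, on every
torus of half-side `S ≥ L_k` at coupling `β_k`: (i) `|⟨P · τ_n Q⟩^c_{k,S}| ≤ M` for `n ≤ S`, and (ii) there are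
weights `a_j ≥ 0`, `Σ_{j=1}^{R_k} a_j ≤ A_k`, with `|⟨P · τ_n Q⟩^c| ≤ Σ_{j=1}^{R_k} a_j |⟨P · τ_{n−j} Q⟩^c|` for
`R_k ≤ n ≤ S` — the shape of the Simon–Lieb inequality [Simon1980CMP, Thm 1.1] specialised to the time direction.
In print ONLY for ferromagnets / abelian models (Griffiths' inequalities); NO non-abelian instance is known or
claimed. No claim. [cite: Simon1980CMP, Theorem 1.1 and Theorem 1.3] -/
def UniformCorrDomination (r : LatticeRep G) (sch : SpeciesScheme ι) (R : ℕ → ℕ) (A : ℕ → ℝ) : Prop :=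
  ∀ P Q : YMSpecies G, ∃ M : ℝ, ∀ᶠ k in atTop, ∀ S : ℕ, sch.L k ≤ S →
    (∀ n : ℕ, n ≤ S → |latticeConnectedCorr r.ρ (sch.β k) (2 * S + 1) P.F Q.F n| ≤ M) ∧
    ∃ a : ℕ → ℝ, (∀ j, 0 ≤ a j) ∧ ∑ j ∈ Finset.Icc 1 (R k), a j ≤ A k ∧
      ∀ n : ℕ, R k ≤ n → n ≤ S →
        |latticeConnectedCorr r.ρ (sch.β k) (2 * S + 1) P.F Q.F n| ≤
          ∑ j ∈ Finset.Icc 1 (R k), a j * |latticeConnectedCorr r.ρ (sch.β k) (2 * S + 1) P.F Q.F (n - j)|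

/-- **`massGap_of_` the domination criterion (kernel).** Uniform finite-range domination along the scheme with
total weights `θ ≤ A_k ≤ 1` (`θ > 0` fixed), ranges `R_k ≥ 1`, and Simon's rate beating the target mass,
`Δ · a_k · R_k ≤ −log A_k` eventually in `k`, implies the Jaffe–Witten lattice clause `HasLatticeMassGap r sch Δ`,
with constant `M/θ` per species pair. Proof: Simon's iteration lemma on each torus (applied to the correlation
sequence truncated beyond `n = S`), then `−log A_k / R_k ≥ Δ a_k`. The criterion is "computable" in the sense of the
package exactly when the domination (ii) can be certified by a finite computation at each `k` — which for SU(N) has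
no known mechanism (schema docstring) and along a scheme would in any case be one certificate per `k`.
[cite: Simon1980CMP, Theorem 1.3] [cite: JaffeWitten2000, §5] -/
theorem hasLatticeMassGap_of_uniformCorrDomination {r : LatticeRep G} {sch : SpeciesScheme ι} {R : ℕ → ℕ}
    {A : ℕ → ℝ} {θ Δ : ℝ} (h : UniformCorrDomination r sch R A) (hθ : 0 < θ)
    (hA : ∀ᶠ k in atTop, θ ≤ A k ∧ A k ≤ 1) (hR : ∀ᶠ k in atTop, 0 < R k)
    (hrate : ∀ᶠ k in atTop, Δ * sch.a k * R k ≤ -Real.log (A k)) :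
    HasLatticeMassGap r sch Δ := by
  intro P Q
  obtain ⟨M, hM⟩ := h P Q
  refine ⟨M / θ, ?_⟩
  filter_upwards [hM, hA, hR, hrate] with k hk hAk hRk hratek S hS n hn
  obtain ⟨hbd, a, ha, hsum, hdom⟩ := hk S hS
  have hAk0 : 0 < A k := hθ.trans_le hAk.1
  -- the truncated correlation sequence
  set f : ℕ → ℝ := fun m => if m ≤ S then latticeConnectedCorr r.ρ (sch.β k) (2 * S + 1) P.F Q.F m else 0
    with hf
  have hfM : ∀ m, |f m| ≤ M := by
    intro m
    by_cases hm : m ≤ S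
    · simp only [hf, if_pos hm]; exact hbd m hm
    · simp only [hf, if_neg hm, abs_zero]; exact (abs_nonneg _).trans (hbd 0 (Nat.zero_le S))
  have hfdom : ∀ m, R k ≤ m → |f m| ≤ ∑ j ∈ Finset.Icc 1 (R k), a j * |f (m - j)| := by
    intro m hm
    by_cases hmS : m ≤ S
    · have hlhs : f m = latticeConnectedCorr r.ρ (sch.β k) (2 * S + 1) P.F Q.F m := by
        simp only [hf, if_pos hmS]
      rw [hlhs]
      refine (hdom m hm hmS).trans (le_of_eq (Finset.sum_congr rfl fun j _ => ?_))
      have hmj : m - j ≤ S := (Nat.sub_le m j).trans hmS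
      simp only [hf, if_pos hmj]
    · have hlhs : f m = 0 := by simp only [hf, if_neg hmS]
      rw [hlhs, abs_zero]
      exact Finset.sum_nonneg fun j _ => mul_nonneg (ha j) (abs_nonneg _)
  have hmain := abs_le_mul_exp_neg_of_domination hfM ha hsum hAk0 hAk.2 hRk hfdom n
  have hfn : f n = latticeConnectedCorr r.ρ (sch.β k) (2 * S + 1) P.F Q.F n := by simp only [hf, if_pos hn]
  rw [hfn] at hmain
  have hM0 : 0 ≤ M := (abs_nonneg _).trans (hbd 0 (Nat.zero_le S))
  -- compare rates and constants
  have hRpos : (0 : ℝ) < R k := by exact_mod_cast hRk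
  have hrate' : Δ * sch.a k ≤ -Real.log (A k) / R k := by
    rw [le_div_iff₀ hRpos]; exact hratek
  refine hmain.trans ?_
  have hexp : Real.exp (-(-Real.log (A k) / R k * n)) ≤ Real.exp (-(Δ * (sch.a k * n))) := by
    refine Real.exp_le_exp.2 (neg_le_neg ?_)
    rw [← mul_assoc]
    exact mul_le_mul_of_nonneg_right hrate' (Nat.cast_nonneg n)
  calc M / A k * Real.exp (-(-Real.log (A k) / R k * n))
      ≤ M / θ * Real.exp (-(-Real.log (A k) / R k * n)) :=
        mul_le_mul_of_nonneg_right (div_le_div_of_nonneg_left hM0 hθ hAk.1) (Real.exp_pos _).le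
    _ ≤ M / θ * Real.exp (-(Δ * (sch.a k * n))) :=
        mul_le_mul_of_nonneg_left hexp (div_nonneg hM0 hθ.le)

/-! ### §C3 The missing finite-size bootstrap for transfer-matrix gaps -/

/-- **The MISSING BOOTSTRAP (hypothesis schema, rows C2/C9 of `ir/CRITERIA.md`): a Knabe-shape finite-size criterion
for the Wilson transfer matrix.** `TransferGapBootstrap ρ S₀ θ κ`: for every coupling `β ≥ 0`, a transfer gap `m > θ`
(lattice units, trace form `TransferGap`) on the spatial torus of half-side `S₀` implies the gap `κ(m − θ)` on every
larger torus. The shape is Knabe's theorem for frustration-free quantum spin chains,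
`γ_N^{per} ≥ ((k−1)/(k−2))(γ_k − 1/(k−1))` [Knabe1988] (threshold lowered in [GossetMozgunov2016]); NO statement of
this shape is in print, or claimed here, for transfer matrices of lattice gauge theories (their
Hamiltonians are not frustration-free and Knabe's operator inequality `H² ≥ c H` from local projector algebra has no
analogue). Recorded because it is EXACTLY what would turn a certified finite-volume gap (seat ir-2:
`exists_pos_transferGap` makes a single one uninformative) into the volume-uniform gap the clause needs. No claim.
[cite: Knabe1988, Theorem] [cite: GossetMozgunov2016, Theorem 1] -/
def TransferGapBootstrap (ρ : G →* Matrix (Fin N) (Fin N) ℂ) (S₀ : ℕ) (θ κ : ℝ) : Prop :=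
  ∀ β : ℝ, 0 ≤ β → ∀ m : ℝ, θ < m → TransferGap ρ β S₀ m → ∀ S : ℕ, S₀ ≤ S → TransferGap ρ β S (κ * (m - θ))

/-- **What the bootstrap would buy (bookkeeping).** Granting `TransferGapBootstrap r.ρ S₀ θ κ`, ONE finite-volume
gap certificate `TransferGap r.ρ β_k S₀ m_k` with `m_k > θ` at EACH sufficiently large `k` (and `β_k ≥ 0`,
`L_k ≥ S₀` eventually) yields the volume-uniform gap `UniformTransferGap r sch (κ(m_k − θ))` that seat ir-2's
certificates (`TransferGapCertificate.lean`: with a uniform thermal-multiplicity bound) convert into the clause.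
Note what remains non-finite even then: one certificate per `k`, i.e. per coupling `β_k → ∞` — a certified
computation covers finitely many couplings, so the large-`β` end needs a THEOREM. (Heuristic motivation, v1.1
re-tag per referee note C-t4r2-ir3-4: the expectation that in lattice units the fixed-volume gap `m(β, S₀) → 0` as
`β → ∞`, so that any fixed threshold `θ` eventually fails, is [analysis, unsourced] — no printed locator is offered and
NOTHING in this file uses it; it only explains why the schema is phrased uniformly in `k`. The provenance tag below
covers the proved bookkeeping implication itself, which is elementary.)
[folklore] -/
theorem uniformTransferGap_of_bootstrap {r : LatticeRep G} {sch : SpeciesScheme ι} {S₀ : ℕ} {θ κ : ℝ}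
    {m : ℕ → ℝ} (hB : TransferGapBootstrap r.ρ S₀ θ κ) (hβ : ∀ᶠ k in atTop, 0 ≤ sch.β k)
    (hL : ∀ᶠ k in atTop, S₀ ≤ sch.L k)
    (hfin : ∀ᶠ k in atTop, θ < m k ∧ TransferGap r.ρ (sch.β k) S₀ (m k)) :
    UniformTransferGap r sch (fun k => κ * (m k - θ)) := by
  filter_upwards [hβ, hL, hfin] with k hβk hLk hk S hS
  exact hB (sch.β k) hβk (m k) hk.1 hk.2 S (hLk.trans hS)

/-! ## v1.1 census addendum (seat ir-3 gen 2, 2026-08-19): criteria C13–C16 of `ir/CRITERIA.md` v2 — PROSE ONLY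

No declaration is added for these four rows, by decision: each hypothesis lives on an object this library does not
have, and an open `def … : Prop` over a posited carrier would be an internally-minted statement with no instance.
Their "⇒ gap" sides, where genuine, land on predicates already typed (seat ir-2: `UniformTorusLogSobolev`,
`UniformDLRLogSobolev`; this file: `UniformCorrDomination` with `R = 1`). Recorded here so the typed census and the
markdown census stay in one place. Verbatim quotations with page/line locators: `ir/CRITERIA.md` §2 Q9–Q14.

* **C13 — multiscale Bakry–Émery / Polchinski-flow log-Sobolev criterion** (Bauerschmidt–Bodineau, CPAM 74 (2021),
  arXiv:1907.12308, Thm 2 of the arXiv text; survey Bauerschmidt–Bodineau–Dagallier, Probab. Surveys 21 (2024),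
  arXiv:2307.07619, Thm 4 for the Riemannian/compact-fibre form). Hypothesis: `Q_t He V_t(φ) Q_t ≥ μ̇_t · id` for ALL
  scales `t ≥ 0` and all `φ`, `V_t` the renormalised potential; conclusion: LSI with `1/γ = ∫₀^∞ e^{−λt−2μ_t} dt`
  provided finite. The only criterion in print whose hypothesis is a property of RG effective potentials scale by
  scale; its globally-convex `t = 0` case for lattice Yang–Mills is the strong-coupling Bakry–Émery result of
  Shen–Zhu–Zhu (CMP 400 (2023); tree package `shen_zhu_zhu`). Verdict: not decidable by finite certified computation
  (a continuum of `N`-dimensional non-convex Hessian bounds, `N = |E|·dim G`), no lattice-gauge application in print,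
  and for the terminal-scale theory the finiteness of `∫ e^{−2μ_t}` over the INFRARED scales is a mass statement — the
  criterion names the missing estimate, it does not make it computable.
* **C14 — 't Hooft electric/magnetic-flux free-energy criteria** (Tomboulis–Yaffe, CMP 100 (1985) 313, via Greensite,
  LNP 821 (2011) (4.44)–(4.47); Kovács–Tomboulis, PRL 85 (2000) 704): `W(C) ≤ (e^{−F_el})^{A(C)/(L_x L_y)}`, so
  `F_mg ∼ L_z L_t e^{−ρ L_x L_y}` suffices for the AREA LAW. A CONFINEMENT criterion, not a criterion for
  `HasLatticeMassGap`; `Z_−/Z_+` is Monte-Carlo data in print, and a certificate would need the ratio of two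
  `4L⁴·dim G`-dimensional integrals to relative precision `e^{−ρ L²}`. Not typed (no twisted-b.c. Wilson measure here).
* **C15 — Migdal–Kadanoff / hierarchical recursions** (Ito, PRL 55 (1985) 558: confinement of the 4D hierarchical
  model; Ito–Seiler, arXiv:0711.4930, on the unproven interpolation inequality in Tomboulis 2007 and on the recursion
  not distinguishing non-abelian from abelian groups). A certifiable computation (character-coefficient recursion) with
  NO implication in print to the Wilson theory beyond one-sided free-energy monotonicity. Not typed.
* **C16 — unit-lattice cluster expansion around a MASSIVE Gaussian** (Bałaban–Imbrie–Jaffe–Brydges, Ann. Phys. 158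
  (1984) 281, Thm 4.1: Abelian Higgs on the unit lattice, `|⟨F G_x⟩ − ⟨F⟩⟨G_x⟩| ≤ e^{−m|x|}`, `m > 0` independent of
  `F, G`, for integral-charge gauge-invariant observables at weak coupling; Goswami, AHP 20 (2019), Thm 2 for `F_μν`).
  This is criterion (a) of the charter done correctly on the WEAK-coupling side, and the in-print blueprint sentence
  reads "renormalization transformations which ultimately map an ε-lattice model onto a unit lattice model, with
  properties similar to the model studied here" — for HIGGS models, where the mass term is in the Lagrangian. For pure
  `YM₄` the premise (a strictly positive bottom of the terminal quadratic form in gauge-invariant directions) is absent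
  at every UV scale; supplying it is the infrared problem. Conclusion side = exponential clustering at the terminal
  scale uniform in `k, Λ`, i.e. `UniformCorrDomination` with `R = 1` ⇒ `hasLatticeMassGap_of_uniformCorrDomination`.

HONEST FRAMING, unchanged: instrument search toward the Clay legs; NO mass-gap claim; verdict of the census NEGATIVE. -/

/-! ## v1.2 (seat ir-3 gen 4, 2026-08-19): §C5 the small-physical-volume regime — floor gap and bootstrap in
PHYSICAL units (row C20 of `ir/CRITERIA.md` v2.4; computation J4A of `ir/COMPUTE-PLAN.md` §10)

WHY THIS SECTION EXISTS. On a spatial torus of small PHYSICAL size `ℓ` (running coupling `g(ℓ)` small) the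
low-lying spectrum of continuum `SU(2)` Yang–Mills is, to lowest order, `E_n = ε_n g^{2/3}(ℓ)/ℓ` with `ε_n` the
eigenvalues of the reduced zero-momentum operator `h = −½Δ + ½ Σ_{i<j} |c_i × c_j|²` on gauge- and
rotation-invariant `L²(ℝ⁹)` ([Luscher1983]; [Vanbaal2001, §4, eq. for `L·H_eff` and "whose energy eigenvalues are
O(g^{2/3}), as can be seen by rescaling c with g^{2/3}"]; lowest eigenvalue `ε₀⁺ = 4.1167` [Pavel2010GlueballSpectrum, p. 10]
(9-digit value `4.116719735` printed in [Vanbaal2001, §4], whose sentence calls it «ε₁ … the mass of the scalar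
glueball» to lowest order — referee ruling C-t4r2-ir3-24, v1.3 DOCFIX: `4.1167` is the vacuum level of `h`; the
lowest-order scalar gap is `μ₁ g^{2/3}/ℓ` with `μ₁ ≈ 2.270` [Pavel2010GlueballSpectrum, Table 1a]; the primaries [Luscher1983],
[LuscherMunster1984] are not held); `h` has purely discrete spectrum: [SimonB1983DiscreteSpectrum, eq. (3), Cor. 4]).
The reduced spectrum is CERTIFIABLE by exact rational Rayleigh–Ritz/Temple arithmetic (package computation J4A, farm
job j055337, D = 15: `ε₀⁺ ≤ 4.116719769044`, `ε₁⁺ ≤ 6.386396130184`, `ε₀⁻ ≤ 8.786712661134` certified; no certified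
lower bound on `ε₁`, hence no certified value of `μ₁`), and the regime coincides with the output of a weak-coupling
renormalisation group run on a torus of small physical size. In the tree's lattice language the only place such
information can enter the clause is a FLOOR hypothesis in physical units — a transfer gap `≥ μ₁·a_k` (lattice
units) on the torus of `S₀ k ≈ ℓ₀/a_k` sites at coupling `β_k`, eventually in `k` — followed by a CONTINUATION
from the floor to all larger volumes. The first is what a finite-volume continuum-limit theorem would deliver
(none is in print: the reduction to `h` is
"Bloch degenerate perturbation theory" [Vanbaal2001, §4], formal in `g^{2/3}`); the second is the infrared problem
itself ([Vanbaal2001, §5]: beyond `z = m ℓ ≈ 5–6` the zero-momentum description breaks down; numerics only). Both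
are typed below as OPEN schemata, asserted nowhere; the bookkeeping theorem says exactly what they would buy. -/

/-- **Floor transfer gap in PHYSICAL units (hypothesis schema, row C20 of `ir/CRITERIA.md` v2.4).** Eventually
in `k`, the spatial torus of half-side `S₀ k` (a floor of roughly fixed physical size `S₀ k · a_k`) at coupling
`β_k` has a transfer gap `≥ μ₁ · a_k` in lattice units, i.e. `≥ μ₁` in physical units (trace form `TransferGap`).
This is the shape in which a finite-volume continuum-limit theorem for the small-volume regime — gap
`= μ g^{2/3}(ℓ₀)/ℓ₀ (1 + o(1))` on the torus of size `ℓ₀` [Luscher1983], [LuscherMunster1984], [Vanbaal2001, §4] —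
would enter; NO such theorem is in print (the reduction is formal perturbation theory) and none is claimed. A single
`k` is uninformative (`exists_pos_transferGap`, seat ir-2); the content is the uniformity in `k`. No claim.
[cite: Vanbaal2001, §4] [cite: Luscher1983, §1] -/
def FloorTransferGap (r : LatticeRep G) (sch : SpeciesScheme ι) (S₀ : ℕ → ℕ) (μ₁ : ℝ) : Prop :=
  ∀ᶠ k in atTop, TransferGap r.ρ (sch.β k) (S₀ k) (μ₁ * sch.a k)

/-- **The missing bootstrap in PHYSICAL units (hypothesis schema, rows C2/C20 of `ir/CRITERIA.md` v2.4).**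
`TransferGapBootstrap` (§C3) with the floor `S₀` and the threshold `θ` allowed to depend on `k` and asked only
eventually and only at the scheme's coupling `β_k`: a transfer gap `m > θ k` on the torus of half-side `S₀ k`
implies the gap `κ (m − θ k)` on every larger torus. With `θ k = μ₀ a_k` this is a threshold in physical units — the
parametrisation under which a floor hypothesis could survive `β_k → ∞` (cf. the `[analysis, unsourced]` remark in
`uniformTransferGap_of_bootstrap`). NOTHING of this shape is in print for lattice gauge theories; the continuation
from a small torus to infinite volume is the infrared problem ([Vanbaal2001, §5]: numerics, no theorem). No claim.
[cite: Knabe1988, Theorem] [cite: Vanbaal2001, §5] -/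
def TransferGapBootstrapPhys (r : LatticeRep G) (sch : SpeciesScheme ι) (S₀ : ℕ → ℕ) (θ : ℕ → ℝ) (κ : ℝ) :
    Prop :=
  ∀ᶠ k in atTop, ∀ m : ℝ, θ k < m → TransferGap r.ρ (sch.β k) (S₀ k) m →
    ∀ S : ℕ, S₀ k ≤ S → TransferGap r.ρ (sch.β k) S (κ * (m - θ k))

/-- The lattice-unit bootstrap of §C3 is the constant special case of the physical-unit one (bookkeeping; needs
`β_k ≥ 0` eventually because §C3 quantifies over `β ≥ 0`). [folklore] -/
theorem transferGapBootstrapPhys_of_bootstrap {r : LatticeRep G} {sch : SpeciesScheme ι} {S₀ : ℕ} {θ κ : ℝ}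
    (hB : TransferGapBootstrap r.ρ S₀ θ κ) (hβ : ∀ᶠ k in atTop, 0 ≤ sch.β k) :
    TransferGapBootstrapPhys r sch (fun _ => S₀) (fun _ => θ) κ := by
  filter_upwards [hβ] with k hβk m hm hgap S hS
  exact hB (sch.β k) hβk m hm hgap S hS

/-- **What floor + bootstrap would buy (bookkeeping, kernel).** A floor gap `≥ μ₁ a_k` on the tori `S₀ k ≤ L_k`,
and the physical-unit bootstrap with threshold `μ₀ a_k`, `μ₀ < μ₁`, give the volume-uniform gap
`UniformTransferGap r sch (κ (μ₁ − μ₀) a_k)` — seat ir-2's currency, which its `TransferGapCertificate.lean` turns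
into the clause `HasLatticeMassGap r sch Δ` for `Δ < κ(μ₁ − μ₀)` GIVEN a uniform thermal-multiplicity bound (and not
alone). Leg (4) along this line = `FloorTransferGap` (UV-type, finite physical volume; not in print) +
`TransferGapBootstrapPhys` (the infrared problem; not in print) + thermal multiplicity. Requires `a_k > 0`
eventually (to make the floor gap strictly exceed the threshold). [folklore] -/
theorem uniformTransferGap_of_floorGap {r : LatticeRep G} {sch : SpeciesScheme ι} {S₀ : ℕ → ℕ} {μ₀ μ₁ κ : ℝ}
    (hF : FloorTransferGap r sch S₀ μ₁)
    (hB : TransferGapBootstrapPhys r sch S₀ (fun k => μ₀ * sch.a k) κ) (hμ : μ₀ < μ₁)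
    (ha : ∀ᶠ k in atTop, 0 < sch.a k) (hL : ∀ᶠ k in atTop, S₀ k ≤ sch.L k) :
    UniformTransferGap r sch (fun k => κ * ((μ₁ - μ₀) * sch.a k)) := by
  filter_upwards [hF, hB, ha, hL] with k hFk hBk hak hLk S hS
  have hlt : μ₀ * sch.a k < μ₁ * sch.a k := mul_lt_mul_of_pos_right hμ hak
  have h := hBk (μ₁ * sch.a k) hlt hFk S (hLk.trans hS)
  have heq : κ * (μ₁ * sch.a k - μ₀ * sch.a k) = κ * ((μ₁ - μ₀) * sch.a k) := by ring
  rw [heq] at h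
  exact h

end Literature.MathematicalPhysics.QuantumFieldTheory.Balaban1983to89.Sufficient
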